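import Mathlib
import HarnessLib
import Summits.AtomisticToContinuum.FouriersLaw.Theses.OddSectorIrreversibility
import Literature.MathematicalPhysics.KineticTheory.LangevinChainKernel
import Literature.MathematicalPhysics.KineticTheory.OddSectorLocalityHypothesis

/-!
# Sketch — crux idea `inner-cone-minkowski-tail` for `ConeScaleCorrector` (E1), ideator 1 (gen 2), round 1

Signatures only (`def … : Prop`; nothing is proved here). Conventions verbatim those of the crux decl:
`P := pinnedChain ω₂ lam β γ`, `μT := volume.withDensity (exp(−H_N/T))` (UNNORMALISED Gibbs weight,
mass `Z`), `J := Σ_i bondCurrent N i`, equilibrium OPEN kernels `P.transitionKernel N T T t`, forecast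
`P_tJ (x) = ∫ J dP_t(x,·)` and its memory function
`A_N(t) = ‖P_tJ‖²_{L²(μ_T)} = OddSectorLocality.forecastNormSq ω₂ lam β γ T N t` — the SAME scalar
function of time through which the landed negative lemma
`oddCorrectorDecay_false_of_oddSectorLocalityHypothesis` (FalseOfLocality) is expressed.

The line: `u_S = u_{S ∧ aN} + ∫_{aN}^{S} P_tJ dt`; conditional Jensen / Einstein–Helfand AHEAD of the
front (`ConeTransportBudget`, the promote seat's C1 = E2's open twin) and MINKOWSKI IN TIME BEHIND it
(`PostCrossingMinkowskiTail`: `∫_{aN}^∞ √A_N(t) dt ≤ C·N·√Z` — OddCorrectorDecay REPAIRED along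
FalseOfLocality's cut: the norm goes inside the time integral only for `t ≥ aN`, with budget `N`, not
`√N`); Fatou along the crux's a.e.-limit predicate. Local form of the new stub (the INNER cone, time-mirror
of E3 `ClosedConeSensitivity`): `ScrambledBlockForecast`.
-/

namespace Summit.AtomisticToContinuum.FouriersLaw.Cruxes.ConeScaleCorrector.IdeatorOneInnerCone

open MeasureTheory Filter Set
open scoped BigOperators ENNReal NNReal Topology

open Literature.MathematicalPhysics.KineticTheory.HeatConduction
open Literature.MathematicalPhysics.KineticTheory

noncomputable section

/-- Unnormalised Gibbs weight `e^{−H_N/T} dq dp` of the crux (verbatim shape; equal by `rfl`-unfolding to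
`OddSectorLocality.gibbsWeight ω₂ lam β γ T N` when `P = pinnedChain ω₂ lam β γ`). -/
def gibbsW (P : OscillatorChain) (N : ℕ) (T : ℝ) : Measure (PhaseSpace N) :=
  volume.withDensity (fun x : PhaseSpace N => ENNReal.ofReal (Real.exp (-(P.hamiltonian N x) / T)))

/-- Its mass `Z = ∫ e^{−H_N/T}` (the crux's right-hand normalisation). -/
def gibbsZ (P : OscillatorChain) (N : ℕ) (T : ℝ) : ℝ :=
  ∫ x, Real.exp (-(P.hamiltonian N x) / T) ∂(volume : Measure (PhaseSpace N))

/-- Total current `J = Σ_i j_i`. -/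
def Jtot (P : OscillatorChain) (N : ℕ) (z : PhaseSpace N) : ℝ := ∑ i : Fin N, P.bondCurrent N i z

/-- Current of the block of bonds `[k₁, k₂)` (as in E2 `SubBallisticWindow`). -/
def Jblock (P : OscillatorChain) (N k₁ k₂ : ℕ) (z : PhaseSpace N) : ℝ :=
  ∑ i : Fin N, (if k₁ ≤ i.val ∧ i.val < k₂ then P.bondCurrent N i z else 0)

/-- Forecast `(P_t f)(x) = ∫ f dP_t(x,·)` under the equilibrium OPEN kernels (time clamped to `ℝ≥0`). -/
def fcast (P : OscillatorChain) (N : ℕ) (T : ℝ) (f : PhaseSpace N → ℝ) (t : ℝ) (x : PhaseSpace N) : ℝ :=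
  ∫ y, f y ∂(P.transitionKernel N T T t.toNNReal x)

/-- Finite-horizon Kubo forecast `u^f_S(x) = ∫₀^S (P_t f)(x) dt` (the crux's own expression for `f = J`). -/
def forecast (P : OscillatorChain) (N : ℕ) (T : ℝ) (f : PhaseSpace N → ℝ) (S : ℝ)
    (x : PhaseSpace N) : ℝ :=
  ∫ t in Set.Ioc (0 : ℝ) S, fcast P N T f t x

/-! ## The two stubs of the line and the bookkeeping -/

/-- **C1 · ConeTransportBudget** (the promote seat's first child of E1, restated; E2's OPEN twin by
conditional Jensen `‖u_τ‖² ≤ Var_π ∫₀^τ J`, i.e. `2∫₀^τ(τ−r)C_N(r)dr ≤ 2τ·sup_{s≤τ}|∫₀^s C_N|`): the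
finite-horizon forecast obeys the Einstein–Helfand envelope `∫ (u_τ)² dμ_T ≤ C·N·(1+τ)·Z` for ALL
`τ ≥ 0` — at most diffusive growth, uniformly in `N`; used only up to `τ = aN`. Harmonic member:
`≍ N·τ²` (ballistic), fails as it must. -/
def ConeTransportBudget : Prop :=
  ∀ ω₂ lam β γ : ℝ, 0 < ω₂ → 0 < lam → 0 < β → 0 < γ → ∀ T : ℝ, 0 < T → ∃ C : ℝ, ∀ N : ℕ, ∀ τ : ℝ,
    0 ≤ τ →
      let P := pinnedChain ω₂ lam β γ
      ∫ x, (forecast P N T (Jtot P N) τ x) ^ 2 ∂(gibbsW P N T) ≤ C * (N : ℝ) * (1 + τ) * gibbsZ P N T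

/-- **FD2 · PostCrossingMinkowskiTail — FIRST LEMMA of the card (the new stub).** For some `a > 0`
(`a ≳ 2/v_B`: both butterfly fronts have swept the chain) and every parameter point there is `C` with,
for every `N`: `t ↦ √A_N(t) = ‖P_tJ_tot‖_{L²(μ_T)}` is integrable on `(aN, ∞)` and
`∫_{aN}^∞ ‖P_tJ_tot‖_{L²(μ_T)} dt ≤ C·N·√Z`.
This is the dead engine `OddCorrectorDecay` REPAIRED along the cut drawn by FalseOfLocality: the norm
is taken inside the time integral only AFTER the causal crossing (where no deterministic forecast is
left to protect it), the budget is `N·√Z` (each bond may keep an `O(1)`, `L¹`-in-time forecast after its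
front) instead of `√N·√Z`, and no parity projection is needed. It implies, by Minkowski,
`‖u_S − u_{aN}‖ ≤ C N √Z` for all `S ≥ aN` (hence the promote seat's C2 `PostCrossingForecast` and the
echo card's (EC′) with `θ = 0`). Harmonic member: `‖P_tJ‖ ≍ √(NZ)·e^{−ct/N}` ⇒ `∫_{aN}^∞ ≍ N^{3/2}√Z`, fails
as it must. Stated over the negative lemma's own memory function `OddSectorLocality.forecastNormSq`. -/
def PostCrossingMinkowskiTail (a : ℝ) : Prop :=
  ∀ ω₂ lam β γ : ℝ, 0 < ω₂ → 0 < lam → 0 < β → 0 < γ → ∀ T : ℝ, 0 < T → ∃ C : ℝ, ∀ N : ℕ,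
    IntegrableOn (fun t : ℝ => Real.sqrt (OddSectorLocality.forecastNormSq ω₂ lam β γ T N t))
        (Set.Ioi (a * (N : ℝ))) ∧
      ∫ t in Set.Ioi (a * (N : ℝ)), Real.sqrt (OddSectorLocality.forecastNormSq ω₂ lam β γ T N t) ≤
        C * (N : ℝ) * Real.sqrt (gibbsZ (pinnedChain ω₂ lam β γ) N T)

/-- **FD1 · ScrambledBlockForecast — the INNER (darkness) cone, local form behind FD2's entry bound.**
There are `a, C₀` with, for every `N`, every block length `ℓ` and every time `t ≥ a·ℓ`: the forecast of
the current of the boundary block of the `ℓ` bonds nearest to the LEFT contact, and of the `ℓ` bonds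
nearest to the RIGHT contact, has `∫ (P_t J_block)² dμ_T ≤ C₀·Z` — `O(1)` IN TOTAL, uniformly in the
block length: a block lying entirely behind the butterfly front of its contact has forgotten its current
(dead single-bond forecasts sum in `L¹(dt)`: `Σ_{i<ℓ} ε(t − a i) ≤ ‖ε‖₁/a`; the hydrodynamic part
telescopes to the two block ends, `κ(ē(0,t) − ē(ℓ,t)) = O(t^{−1/4})`). Time-mirror of E3
`ClosedConeSensitivity` (nothing moves BEFORE `t = a·d`; nothing is remembered AFTER). Harmonic member:
`≍ ℓ·Z` (phonons alive), fails as it must. Not used by the glue; it is the localisation target and the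
numerical observable (replica overlap of block currents). -/
def ScrambledBlockForecast (a : ℝ) : Prop :=
  ∀ ω₂ lam β γ : ℝ, 0 < ω₂ → 0 < lam → 0 < β → 0 < γ → ∀ T : ℝ, 0 < T → ∃ C₀ : ℝ, ∀ N ℓ : ℕ, ∀ t : ℝ,
    a * (ℓ : ℝ) ≤ t →
      let P := pinnedChain ω₂ lam β γ
      ∫ x, (fcast P N T (Jblock P N 0 ℓ) t x) ^ 2 ∂(gibbsW P N T) ≤ C₀ * gibbsZ P N T ∧
        ∫ x, (fcast P N T (Jblock P N (N - 1 - ℓ) (N - 1)) t x) ^ 2 ∂(gibbsW P N T) ≤ C₀ * gibbsZ P N T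

/-- **Fixed-N bookkeeping** (from the CONSTRUCTED kernels; no N-uniform content): the explicit forecasts
are in `L²(μ_T)`, and MINKOWSKI for this family — for `aN ≤ S`,
`‖u_S − u_{aN}‖_{L²(μ_T)} ≤ ∫_{(aN,S]} ‖P_tJ‖_{L²(μ_T)} dt` whenever the right side is finite (joint
measurability of `(t,x) ↦ P_tJ(x)` + `norm_integral_le_integral_norm` in `L²`). -/
def ForecastBookkeeping (a : ℝ) : Prop :=
  ∀ ω₂ lam β γ : ℝ, 0 < ω₂ → 0 < lam → 0 < β → 0 < γ → ∀ T : ℝ, 0 < T → ∀ N : ℕ, ∀ S : ℝ, 0 ≤ S →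
    let P := pinnedChain ω₂ lam β γ
    MemLp (forecast P N T (Jtot P N) S) 2 (gibbsW P N T) ∧
      (a * (N : ℝ) ≤ S →
        IntegrableOn (fun t : ℝ => Real.sqrt (OddSectorLocality.forecastNormSq ω₂ lam β γ T N t))
            (Set.Ioc (a * (N : ℝ)) S) →
          Real.sqrt (∫ x, (forecast P N T (Jtot P N) S x - forecast P N T (Jtot P N) (a * N) x) ^ 2
              ∂(gibbsW P N T)) ≤
            ∫ t in Set.Ioc (a * (N : ℝ)) S,
              Real.sqrt (OddSectorLocality.forecastNormSq ω₂ lam β γ T N t))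

/-- **Glue shape** (pure bookkeeping, so that triage can check the cut): for `S ≥ aN`,
`‖u_S‖ ≤ ‖u_{aN}‖ + ∫_{aN}^∞ ‖P_tJ‖ ≤ √(C₁N(1+aN)Z) + C₂N√Z ≤ C N √Z` (`N ≥ 1`; `N = 0` is the point
space), for `S ≤ aN` the budget alone; then FATOU along the crux's a.e.-limit hypothesis
(`∫u² ≤ liminf_S ∫u_S²`, `MemLp` of the a.e. limit) — the route decl BY NAME, `C_E1 = (√(C₁(1+a)) + C₂)²`.
The corrector predicate is used only through Fatou (honours Disproof §2a); both stubs fail at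
`lam = β = 0` (honours §2b, now unconditional `harmonic_corrector_exceeds`); no `Pow 1` claim (§4). -/
def InnerConeGlue : Prop :=
  ∀ a : ℝ, 0 < a → ConeTransportBudget → PostCrossingMinkowskiTail a → ForecastBookkeeping a →
    Summit.AtomisticToContinuum.FouriersLaw.Theses.OddSectorIrreversibility.ConeScaleCorrector

/-! ## Consistency probes (definitional) -/

/-- The crux's `μT` is this file's `gibbsW` and the Literature file's `OddSectorLocality.gibbsWeight`. -/
example (ω₂ lam β γ T : ℝ) (N : ℕ) :
    gibbsW (pinnedChain ω₂ lam β γ) N T = OddSectorLocality.gibbsWeight ω₂ lam β γ T N := rfl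

/-- The Literature forecast `currentForecast` is this file's `fcast … (Jtot …)`. -/
example (ω₂ lam β γ T : ℝ) (N : ℕ) (t : ℝ) (x : PhaseSpace N) :
    OddSectorLocality.currentForecast ω₂ lam β γ T N t x =
      fcast (pinnedChain ω₂ lam β γ) N T (Jtot (pinnedChain ω₂ lam β γ) N) t x := rfl

end

end Summit.AtomisticToContinuum.FouriersLaw.Cruxes.ConeScaleCorrector.IdeatorOneInnerCone
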